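import Mathlib.LinearAlgebra.Eigenspace.Basic
import Mathlib.LinearAlgebra.FiniteDimensional.Defs
import Mathlib.FieldTheory.Minpoly.Field
import Mathlib.Algebra.Polynomial.RingDivision
import Mathlib.RingTheory.PrincipalIdealDomain
import HarnessLib

/-!
# The boundary annihilator (BND) from the vanishing of a joint generalised eigenspace: pure linear algebra
# (spectral projectors as Hecke WORDS `q₁(T₁) ⋯ q_m(T_m)` with `qᵢ ≡ 1 mod (X − λᵢ)^{kᵢ}`)

Summit `BirchSwinnertonDyer`, route `ManinLocalTwoThree` (cell bsd-f2-manin), cruxes C2 `ManinOddAtFour`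
(stmt-BirchSwinnertonDyer-22967) / C3 `ManinPrimeToThreeAtNine` (stmt-BirchSwinnertonDyer-22968); registered stubs
`stub_relativeIharaBarTwo` / `stub_relativeIharaBar331` = leaf E-es-25 ⟸ E-es-35 ⟸ (PAR) ∧ (BND)
(`Theorems/ManinLocalTwoThreeShiftInvariantIsDiamondAssembly.lean`, p3).  The hypothesis (BND) of the LIFT
(`exists_shift_invariant_lift_of_boundaryKilled`) asks for a WORD of Hecke polynomials `q_r(T_r)`, each
`q_r ≡ 1 mod (X − λ(r))^{k_r}` for prescribed exponents, killing the boundary symbols of level `L tⁿ`.  E-es-30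
(`BoundaryEisenstein`, p2) delivers instead: on the finite-dimensional Hecke-stable module `B` of boundary symbols, on which
the `T_r` commute, the joint generalised `λ`-eigenspace for finitely many primes `r ∈ F` is zero (for `λ̄` non-Eisenstein).
This file is the bridge, for an ABSTRACT family of endomorphisms `T i` of a module `E` preserving a finite-dimensional
submodule `B` on which they commute:

* `exists_finset_forall_mem_imp_eq_zero` — finiteness: if the vectors of `B` lying in ALL `maxGenEigenspace (T i) (λ i)`,
  `i ∈ I` (any index set), are `0`, the same holds for some FINITE `F ⊆ I` (descending chain in `B`);
* `exists_heckeWord_annihilating` — **(BND) abstract**: if `B ⊓ ⨅_{i ∈ F} maxGenEigenspace (T i) (λ i) = 0` for a finite `F`,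
  then for every `k` there are `q i ∈ K[X]` with `(X − C(λ i))^{k i} ∣ q i − 1` such that the word
  `F.toList.foldr (fun i y ↦ aeval (T i) (q i) y)` kills `B`.  Construction: `minpoly (T i|_B) = (X − λᵢ)^{eᵢ} νᵢ`,
  Bézout `aᵢ (X − λᵢ)^{kᵢ} + bᵢ νᵢ = 1`, `qᵢ := bᵢ νᵢ`; then `(Tᵢ − λᵢ)^{eᵢ} qᵢ(Tᵢ) = bᵢ(Tᵢ)·minpoly(Tᵢ) = 0` on `B`, so the
  word maps `B` into the joint generalised eigenspace, i.e. to `0` (the factors commute on `B`).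

Nothing here is specific to modular symbols; nothing about BSD or Manin's conjecture is proved by this file.
References: HOME/MEMO-es.md §23.2 (cell bsd-f2-manin); N. Bourbaki, *Algèbre* VII §5 (primary decomposition).
-/

set_option autoImplicit false
set_option linter.dupNamespace false

open scoped Polynomial

open Polynomial

namespace Summit.BirchSwinnertonDyer.BirchSwinnertonDyer.Theorems.ManinLocalTwoThree

/-! ### §1  Restriction of polynomial operators to a stable submodule -/

section Restrict

variable {K E : Type*} [Field K] [AddCommGroup E] [Module K E] (B : Submodule K E)

/-- `q(T|_B) = q(T)|_B` on elements (plumbing). [folklore] -/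
theorem coe_aeval_restrict (T : Module.End K E) (hT : ∀ x ∈ B, T x ∈ B) (q : K[X]) (x : B) :
    ((aeval (T.restrict hT) q x : B) : E) = aeval T q (x : E) := by
  induction q using Polynomial.induction_on' with
  | add p q hp hq => rw [map_add, map_add, LinearMap.add_apply, LinearMap.add_apply, Submodule.coe_add, hp, hq]
  | monomial n a =>
    rw [aeval_monomial, aeval_monomial, Module.End.mul_apply, Module.End.mul_apply, Module.algebraMap_end_apply,
      Module.algebraMap_end_apply, Submodule.coe_smul]
    congr 1
    induction n generalizing x with
    | zero => simp
    | succ n ih => rw [pow_succ, Module.End.mul_apply, pow_succ, Module.End.mul_apply, ih, LinearMap.coe_restrict_apply]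

/-- `q(T)` preserves `B` when `T` does. [folklore] -/
theorem aeval_mem_of_mem (T : Module.End K E) (hT : ∀ x ∈ B, T x ∈ B) (q : K[X]) {x : E} (hx : x ∈ B) :
    aeval T q x ∈ B := by
  have := (aeval (T.restrict hT) q ⟨x, hx⟩).2
  rwa [coe_aeval_restrict B T hT q ⟨x, hx⟩] at this

/-- Polynomials in commuting endomorphisms commute. [folklore] -/
theorem commute_aeval_aeval {A : Type*} [Ring A] [Algebra K A] {a b : A} (h : Commute a b) (p q : K[X]) :
    Commute (aeval a p) (aeval b q) := by
  have h1 : ∀ q : K[X], Commute a (aeval b q) := by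
    intro q
    induction q using Polynomial.induction_on' with
    | add p q hp hq => rw [map_add]; exact hp.add_right hq
    | monomial n c => rw [aeval_monomial, Algebra.algebraMap_eq_smul_one, smul_mul_assoc, one_mul]; exact (h.pow_right n).smul_right c
  induction p using Polynomial.induction_on' with
  | add p p' hp hp' => rw [map_add]; exact hp.add_left hp'
  | monomial n c =>
    rw [aeval_monomial, Algebra.algebraMap_eq_smul_one, smul_mul_assoc, one_mul]
    exact ((h1 q).pow_left n).smul_left c

end Restrict

/-! ### §2  Finiteness: a vanishing joint generalised eigenspace in a finite-dimensional `B` is detected by finitely many operators -/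

section Finiteness

variable {K E : Type*} [Field K] [AddCommGroup E] [Module K E] (B : Submodule K E) [FiniteDimensional K B]
  {ι : Type*} (T : ι → Module.End K E) (lam : ι → K)

/-- **Finiteness.**  If every `x ∈ B` lying in all the generalised eigenspaces `maxGenEigenspace (T i) (λ i)`, `i ∈ I`, is
`0`, then there is a finite `F ⊆ I` with the same property (choose `F` minimising the dimension of
`B ⊓ ⨅_{i∈F}`; adding any `j ∈ I` cannot shrink it further, so the minimum lies in every `maxGenEigenspace (T j)`). [folklore] -/
theorem exists_finset_forall_mem_imp_eq_zero (I : Set ι)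
    (h : ∀ x ∈ B, (∀ i ∈ I, x ∈ (T i).maxGenEigenspace (lam i)) → x = 0) :
    ∃ F : Finset ι, (↑F ⊆ I) ∧ ∀ x ∈ B, (∀ i ∈ F, x ∈ (T i).maxGenEigenspace (lam i)) → x = 0 := by
  classical
  -- the submodules `W F := B ⊓ ⨅_{i ∈ F} maxGenEigenspace`
  let W : Finset ι → Submodule K E := fun F => B ⊓ ⨅ i ∈ F, (T i).maxGenEigenspace (lam i)
  have hWB : ∀ F, W F ≤ B := fun F => inf_le_left
  haveI : ∀ F, FiniteDimensional K (W F) := fun F => Submodule.finiteDimensional_of_le (hWB F)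
  -- minimise the dimension over finite subsets of `I`
  have hex : ∃ m : ℕ, ∃ F : Finset ι, ↑F ⊆ I ∧ Module.finrank K (W F) = m := ⟨_, ∅, by simp, rfl⟩
  obtain ⟨F, hFI, hFm⟩ := Nat.find_spec hex
  have hmin : ∀ F' : Finset ι, ↑F' ⊆ I → Module.finrank K (W F) ≤ Module.finrank K (W F') := by
    intro F' hF'I
    rw [hFm]
    exact Nat.find_min' hex ⟨F', hF'I, rfl⟩
  refine ⟨F, hFI, fun x hxB hx => ?_⟩
  have hxW : x ∈ W F := by
    simp only [W, Submodule.mem_inf, Submodule.mem_iInf]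
    exact ⟨hxB, fun i hi => hx i hi⟩
  -- `W F ≤ maxGenEigenspace (T j)` for every `j ∈ I`
  have hle : ∀ j ∈ I, W F ≤ (T j).maxGenEigenspace (lam j) := by
    intro j hj
    have hsub : W (insert j F) ≤ W F := by
      refine inf_le_inf_left _ ?_
      exact biInf_mono (fun i hi => Finset.mem_insert_of_mem hi)
    have hI' : ↑(insert j F) ⊆ I := by
      rw [Finset.coe_insert]; exact Set.insert_subset hj hFI
    have heq : W (insert j F) = W F :=
      Submodule.eq_of_le_of_finrank_le hsub (hmin (insert j F) hI')
    intro y hy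
    rw [← heq] at hy
    simp only [W, Submodule.mem_inf, Submodule.mem_iInf] at hy
    exact hy.2 j (Finset.mem_insert_self j F)
  exact h x hxB fun i hi => hle i hi hxW

end Finiteness

/-! ### §3  The annihilating word -/

section Word

variable {K E : Type*} [Field K] [AddCommGroup E] [Module K E] (B : Submodule K E) [FiniteDimensional K B]
  {ι : Type*} (T : ι → Module.End K E) (hTB : ∀ i, ∀ x ∈ B, T i x ∈ B)
  (hcomm : ∀ i j, ∀ x ∈ B, T i (T j x) = T j (T i x)) (lam : ι → K)

include hTB hcomm

/-- **The annihilating Hecke word (abstract (BND)).**  Let the `T i` preserve the finite-dimensional submodule `B` and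
commute on it, and let `F` be a finite set of indices such that the only `x ∈ B` lying in every
`maxGenEigenspace (T i) (λ i)`, `i ∈ F`, is `0`.  Then for every `k : ι → ℕ` there are polynomials `q i` with
`(X − C (λ i))^{k i} ∣ q i − 1` such that the word `F.toList.foldr (fun i y ↦ q_i(T_i) y)` kills every `x ∈ B`. [folklore] -/
theorem exists_heckeWord_annihilating (F : Finset ι)
    (hbot : ∀ x ∈ B, (∀ i ∈ F, x ∈ (T i).maxGenEigenspace (lam i)) → x = 0) (k : ι → ℕ) :
    ∃ q : ι → K[X], (∀ i ∈ F, (X - C (lam i)) ^ (k i) ∣ q i - 1) ∧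
      ∀ x ∈ B, F.toList.foldr (fun i y => aeval (T i) (q i) y) x = 0 := by
  classical
  -- restrictions to `B`
  let T' : ι → Module.End K B := fun i => (T i).restrict (hTB i)
  have hT'comm : ∀ i j, Commute (T' i) (T' j) := by
    intro i j
    ext x
    exact hcomm i j x x.2
  -- minimal polynomials and their `λ`-primary factorisation
  have hint : ∀ i, IsIntegral K (T' i) := fun i => Algebra.IsIntegral.isIntegral (T' i)
  have hμ : ∀ i, ∃ e : ℕ, ∃ ν : K[X], minpoly K (T' i) = (X - C (lam i)) ^ e * ν ∧ ¬ (X - C (lam i)) ∣ ν := by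
    intro i
    obtain ⟨ν, hν, hndvd⟩ := Polynomial.exists_eq_pow_rootMultiplicity_mul_and_not_dvd (minpoly K (T' i))
      (minpoly.ne_zero (hint i)) (lam i)
    exact ⟨_, ν, hν, hndvd⟩
  choose e ν hμν hndvd using hμ
  -- Bézout: `a (X-λ)^k + b ν = 1`
  have hbez : ∀ i, ∃ a b : K[X], a * (X - C (lam i)) ^ (k i) + b * ν i = 1 := by
    intro i
    have hcop : IsCoprime ((X - C (lam i)) ^ (k i)) (ν i) :=
      (((Polynomial.irreducible_X_sub_C (lam i)).coprime_iff_not_dvd).2 (hndvd i)).pow_left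
    exact hcop
  choose a b hab using hbez
  refine ⟨fun i => b i * ν i, fun i _ => ⟨-a i, by linear_combination hab i⟩, ?_⟩
  -- the key identity on `B`: `(T'ᵢ − λᵢ)^{eᵢ} ∘ qᵢ(T'ᵢ) = 0`
  have hkill : ∀ i, (T' i - lam i • (1 : Module.End K B)) ^ (e i) * aeval (T' i) (b i * ν i) = 0 := by
    intro i
    have e1 : (T' i - lam i • (1 : Module.End K B)) ^ (e i) = aeval (T' i) ((X - C (lam i)) ^ (e i)) := by
      rw [map_pow, map_sub, aeval_X, aeval_C, Algebra.algebraMap_eq_smul_one]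
    rw [e1, ← map_mul, show (X - C (lam i)) ^ e i * (b i * ν i) = b i * minpoly K (T' i) by rw [hμν i]; ring,
      map_mul, minpoly.aeval, mul_zero]
  -- the word on `B` as an endomorphism of `B`
  let w' : List ι → Module.End K B := fun l => (l.map fun i => aeval (T' i) (b i * ν i)).prod
  have hw'coe : ∀ (l : List ι) (x : B), ((w' l x : B) : E) = l.foldr (fun i y => aeval (T i) (b i * ν i) y) (x : E) := by
    intro l
    induction l with
    | nil => intro x; rfl
    | cons i l ih =>
      intro x
      show (((aeval (T' i) (b i * ν i) * w' l) x : B) : E) = _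
      rw [Module.End.mul_apply, coe_aeval_restrict B (T i) (hTB i), List.foldr_cons, ih]
  -- every factor commutes with `(T'ᵢ − λᵢ)^{eᵢ}`, hence so does every word
  have hcommw : ∀ (i : ι) (l : List ι), Commute ((T' i - lam i • (1 : Module.End K B)) ^ (e i)) (w' l) := by
    intro i l
    have hc : ∀ j, Commute ((T' i - lam i • (1 : Module.End K B)) ^ (e i)) (aeval (T' j) (b j * ν j)) := by
      intro j
      have : (T' i - lam i • (1 : Module.End K B)) ^ (e i) = aeval (T' i) ((X - C (lam i)) ^ (e i)) := by
        rw [map_pow, map_sub, aeval_X, aeval_C, Algebra.algebraMap_eq_smul_one]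
      rw [this]
      exact commute_aeval_aeval (hT'comm i j) _ _
    induction l with
    | nil => exact Commute.one_right _
    | cons j l ih =>
      show Commute _ (aeval (T' j) (b j * ν j) * w' l)
      exact (hc j).mul_right ih
  -- the word maps `B` into each generalised eigenspace
  have hgen : ∀ i ∈ F, ∀ x : B, ((T' i - lam i • (1 : Module.End K B)) ^ (e i)) (w' F.toList x) = 0 := by
    intro i hi x
    obtain ⟨s, t', hst⟩ := List.append_of_mem (Finset.mem_toList.mpr hi)
    have hsplit : w' F.toList = w' s * (aeval (T' i) (b i * ν i) * w' t') := by
      show (F.toList.map _).prod = (s.map _).prod * (aeval (T' i) (b i * ν i) * (t'.map _).prod)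
      rw [hst, List.map_append, List.prod_append, List.map_cons, List.prod_cons]
    rw [hsplit, Module.End.mul_apply, ← Module.End.mul_apply (f := (T' i - _) ^ e i), (hcommw i s).eq,
      Module.End.mul_apply, Module.End.mul_apply, ← Module.End.mul_apply (f := (T' i - _) ^ e i), hkill i,
      LinearMap.zero_apply, map_zero]
  intro x hx
  rw [← hw'coe F.toList ⟨x, hx⟩]
  have hz : ((w' F.toList ⟨x, hx⟩ : B) : E) = 0 := by
    refine hbot _ (w' F.toList ⟨x, hx⟩).2 fun i hi => ?_
    rw [Module.End.mem_maxGenEigenspace]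
    refine ⟨e i, ?_⟩
    -- transport `hgen` to the ambient space
    have h1 := congrArg (fun y : B => (y : E)) (hgen i hi ⟨x, hx⟩)
    simp only [Submodule.coe_zero] at h1
    rw [← h1]
    -- `((T − λ)^e restricted) = restriction of (T − λ)^e`
    have inner : ∀ y : B, (T i - lam i • (1 : Module.End K E)) (y : E) =
        (((T' i - lam i • (1 : Module.End K B)) y : B) : E) := fun y => by
      simp [T', LinearMap.sub_apply, LinearMap.coe_restrict_apply]
    generalize (w' F.toList ⟨x, hx⟩) = y
    induction (e i) generalizing y with
    | zero => simp
    | succ m ih =>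
      rw [pow_succ, Module.End.mul_apply, pow_succ, Module.End.mul_apply, inner, ih]
  exact hz

end Word

end Summit.BirchSwinnertonDyer.BirchSwinnertonDyer.Theorems.ManinLocalTwoThree
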